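import Literature.NumberTheory.Transcendental.KZLogCalculusProofs
import Summits.KontsevichZagierPeriods.KontsevichZagierPeriods.Theorems.ValuedFieldSpecialisationClassLevelExpansionFibreDimOneToolkit

/-!
# Route ValuedFieldSpecialisation — fibrewise substitutions along the last coordinate are fibred moves

Helper for item stmt-KontsevichZagierPeriods-3503 (`ClassLevelExpansionFibreDimOne`). Over a base
`G ⊆ ℝᵐ⁺¹` of dimension `≥ 1` (so that the parameter `z 0` is a base coordinate) consider a band
`B = {(y, t) | y ∈ G, a y ≤ t ≤ b y}` and a FIBREWISE SUBSTITUTION `t ↦ ψ(y, t)`: `ψ` is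
`ℚ`-semialgebraic on `B`, differentiable on an open `U ⊇ B`, and strictly increasing on every
closed fibre. Then `Φ(y, t) = (y, ψ(y, t))` carries `B` onto the band with edges
`ψ(y, a y) ≤ ψ(y, b y)` (intermediate value theorem), is injective, `ℚ`-semialgebraic, with
derivative `w ↦ (init w, dψ(w))` of determinant `∂ψ/∂t` (`LinearMap.det_of_snoc_init`), and fixes
`z 0`; so for representations `r` on `B` and `r'` on the image band with
`r.integrand z = r'.integrand (Φ z) · ∂ψ/∂t (z)` (`∂ψ/∂t > 0`) the difference `[r] − [r']` is a
FIBRED change of variables (`of_sub_of_mem_fibredRelations_fibreSubst`). Special cases: affine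
`ψ = α(y) + β(y) t` (scalings `y ↦ y/s^γ`, translations `x ↦ x − θ(s)`), power maps
`ψ = t^κ` — the substitutions that normalise `y`-ranges `[φ₁(s), φ₂(s)]` of log families and
recenter cells of a preparation.

Sources: M. Kontsevich, D. Zagier, *Periods* (2001), §1.2, rule (2) (the tree's affine case is
`KZ.of_sub_of_mem_relations_of_affine`); the fibred calculus is this route's.
-/

noncomputable section

namespace Summit.KontsevichZagierPeriods.ValuedFieldSpecialisation

open MeasureTheory Set Filter
open scoped Topology
open Literature.NumberTheory.Transcendental Literature.NumberTheory.Transcendental.KZ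
open Literature.ModelTheory.ExponentialFields (IsSemialgebraic)

/-- Decomposing a vector of `ℝᵐ⁺²` into its `init` part and its last coordinate. [folklore] -/
theorem snoc_init_zero_add_single {m : ℕ} (w : Fin (m + 1 + 1) → ℝ) :
    (Fin.snoc (Fin.init w) 0 : Fin (m + 1 + 1) → ℝ) + w (Fin.last (m + 1)) • Pi.single (Fin.last (m + 1)) 1 = w := by
  ext i
  refine Fin.lastCases ?_ (fun j => ?_) i
  · simp
  · simp [Fin.init, (Fin.castSucc_lt_last j).ne]

/-- **The data of a fibrewise substitution.** For `ψ` as in the module docstring (semialgebraic on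
the band, differentiable on an open `U ⊇ band`, strictly increasing on the closed fibres) the map
`Φ z = snoc (init z) (ψ z)` is a `ℚ`-semialgebraic injective map of the band onto the band with
edges `ψ(y, a y)`, `ψ(y, b y)`, differentiable within the band with a derivative of determinant
`∂ψ/∂t`, and it fixes `z 0`. [Kontsevich–Zagier 2001, §1.2, rule (2)] [folklore] -/
theorem fibreSubst_data {m : ℕ} {G : Set (Fin (m + 1) → ℝ)}
    {a b : (Fin (m + 1) → ℝ) → ℝ} (ha : IsSemialgebraicFunOn ℚ G a) (hb : IsSemialgebraicFunOn ℚ G b)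
    (hab : ∀ y ∈ G, a y ≤ b y)
    {ψ : (Fin (m + 1 + 1) → ℝ) → ℝ} {U : Set (Fin (m + 1 + 1) → ℝ)} (hUo : IsOpen U)
    (hBU : KZlog.band G a b ⊆ U) (hψsa : IsSemialgebraicFunOn ℚ (KZlog.band G a b) ψ)
    (hψd : DifferentiableOn ℝ ψ U)
    (hψmono : ∀ y ∈ G, StrictMonoOn (fun t : ℝ => ψ (Fin.snoc y t)) (Icc (a y) (b y))) :
    ∃ Φ' : (Fin (m + 1 + 1) → ℝ) → (Fin (m + 1 + 1) → ℝ) →L[ℝ] (Fin (m + 1 + 1) → ℝ),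
      IsSemialgebraicMapOn ℚ (KZlog.band G a b) (fun z => Fin.snoc (Fin.init z) (ψ z)) ∧
      (∀ z ∈ KZlog.band G a b, HasFDerivWithinAt (fun z => (Fin.snoc (Fin.init z) (ψ z) : Fin (m + 1 + 1) → ℝ))
        (Φ' z) (KZlog.band G a b) z) ∧
      InjOn (fun z => (Fin.snoc (Fin.init z) (ψ z) : Fin (m + 1 + 1) → ℝ)) (KZlog.band G a b) ∧
      (fun z => (Fin.snoc (Fin.init z) (ψ z) : Fin (m + 1 + 1) → ℝ)) '' KZlog.band G a b =
        KZlog.band G (fun y => ψ (Fin.snoc y (a y))) (fun y => ψ (Fin.snoc y (b y))) ∧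
      (∀ z, (Φ' z).det = fderiv ℝ ψ z (Pi.single (Fin.last (m + 1)) 1)) ∧
      (∀ z, (Fin.snoc (Fin.init z) (ψ z) : Fin (m + 1 + 1) → ℝ) 0 = z 0) := by
  have hBsa : IsSemialgebraic ℚ (KZlog.band G a b) := KZlog.isSemialgebraic_band ha hb
  have hzU : ∀ z ∈ KZlog.band G a b, z ∈ U := fun z hz => hBU hz
  -- the substitution and its derivative
  set Φ : (Fin (m + 1 + 1) → ℝ) → (Fin (m + 1 + 1) → ℝ) := fun z => Fin.snoc (Fin.init z) (ψ z) with hΦ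
  let Φ' : (Fin (m + 1 + 1) → ℝ) → (Fin (m + 1 + 1) → ℝ) →L[ℝ] (Fin (m + 1 + 1) → ℝ) := fun z =>
    ContinuousLinearMap.pi
      (Fin.lastCases (motive := fun _ => (Fin (m + 1 + 1) → ℝ) →L[ℝ] ℝ) (fderiv ℝ ψ z)
        (fun i => ContinuousLinearMap.proj (Fin.castSucc i)))
  have hΦ' : ∀ z w, Φ' z w = Fin.snoc (Fin.init w) (fderiv ℝ ψ z w) := by
    intro z w
    funext i
    refine Fin.lastCases ?_ (fun j => ?_) i
    · simp [Φ']
    · simp [Φ', Fin.init]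
  -- determinant `= ∂ψ/∂t`
  have hdet : ∀ z, (Φ' z).det = fderiv ℝ ψ z (Pi.single (Fin.last (m + 1)) 1) := by
    intro z
    let ℓ : (Fin (m + 1) → ℝ) →ₗ[ℝ] ℝ :=
      ((fderiv ℝ ψ z : (Fin (m + 1 + 1) → ℝ) →L[ℝ] ℝ) : (Fin (m + 1 + 1) → ℝ) →ₗ[ℝ] ℝ).comp
        (LinearMap.pi (Fin.lastCases (motive := fun _ => (Fin (m + 1) → ℝ) →ₗ[ℝ] ℝ) 0
          (fun i => LinearMap.proj i)))
    have hℓ : ∀ w' : Fin (m + 1) → ℝ, ℓ w' = fderiv ℝ ψ z (Fin.snoc w' 0) := by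
      intro w'
      simp only [ℓ, LinearMap.coe_comp, Function.comp_apply, ContinuousLinearMap.coe_coe]
      congr 1
      funext i
      refine Fin.lastCases ?_ (fun j => ?_) i <;> simp
    have h := LinearMap.det_of_snoc_init (Φ' z : (Fin (m + 1 + 1) → ℝ) →ₗ[ℝ] (Fin (m + 1 + 1) → ℝ))
      LinearMap.id ℓ (fderiv ℝ ψ z (Pi.single (Fin.last (m + 1)) 1)) (fun w => by
        rw [ContinuousLinearMap.coe_coe, hΦ', LinearMap.id_apply, hℓ]
        congr 1
        conv_lhs => rw [← snoc_init_zero_add_single w]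
        rw [map_add, map_smul, smul_eq_mul, mul_comm])
    rw [LinearMap.det_id, mul_one] at h
    exact h
  -- derivative
  have hderiv : ∀ z ∈ KZlog.band G a b, HasFDerivAt Φ (Φ' z) z := by
    intro z hz
    rw [hasFDerivAt_pi']
    intro i
    refine Fin.lastCases ?_ (fun j => ?_) i
    · have hd : HasFDerivAt ψ (fderiv ℝ ψ z) z :=
        ((hψd z (hzU z hz)).differentiableAt (hUo.mem_nhds (hzU z hz))).hasFDerivAt
      have hfun : (fun x => Φ x (Fin.last (m + 1))) = ψ := by funext x; simp [hΦ]
      rw [hfun]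
      refine hd.congr_fderiv (ContinuousLinearMap.ext fun w => ?_)
      simp [hΦ']
    · have hfun : (fun x => Φ x (Fin.castSucc j)) = fun x => x (Fin.castSucc j) := by
        funext x; simp [hΦ, Fin.init]
      rw [hfun]
      refine (hasFDerivAt_apply (Fin.castSucc j) z).congr_fderiv (ContinuousLinearMap.ext fun w => ?_)
      simp [hΦ', Fin.init]
  -- continuity on the closed fibres (from differentiability on `U ⊇ band`)
  have hcont : ∀ y ∈ G, ContinuousOn (fun t : ℝ => ψ (Fin.snoc y t)) (Icc (a y) (b y)) := by
    intro y hy t ht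
    have hzB : (Fin.snoc y t : Fin (m + 1 + 1) → ℝ) ∈ KZlog.band G a b := KZlog.snoc_mem_band.2 ⟨hy, ht⟩
    have hc : ContinuousAt ψ (Fin.snoc y t) :=
      ((hψd _ (hBU hzB)).differentiableAt (hUo.mem_nhds (hBU hzB))).continuousAt
    have hs : Continuous fun t : ℝ => (Fin.snoc y t : Fin (m + 1 + 1) → ℝ) := by
      refine continuous_pi fun i => ?_
      refine Fin.lastCases ?_ (fun j => ?_) i
      · simp only [Fin.snoc_last]; exact continuous_id
      · simp only [Fin.snoc_castSucc]; exact continuous_const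
    exact (hc.comp hs.continuousAt).continuousWithinAt
  refine ⟨Φ', ?_, fun z hz => (hderiv z hz).hasFDerivWithinAt, ?_, ?_, hdet, fun z => ?_⟩
  · -- semialgebraic map
    refine (isSemialgebraicMapOn_iff_forall_holds hBsa).mpr fun i => ?_
    refine Fin.lastCases ?_ (fun j => ?_) i
    · exact hψsa.congr fun z _ => by simp [hΦ]
    · exact (isSemialgebraicFunOn_aeval hBsa
        (MvPolynomial.X (Fin.castSucc j))).congr fun z _ => by simp [hΦ, Fin.init]
  · -- injective
    intro z₁ hz₁ z₂ hz₂ h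
    have hy : Fin.init z₁ = Fin.init z₂ := by
      have := congrArg Fin.init h
      simpa [hΦ] using this
    have hl : ψ z₁ = ψ z₂ := by
      have := congrFun h (Fin.last (m + 1))
      simpa [hΦ] using this
    have h1 : z₁ = Fin.snoc (Fin.init z₁) (z₁ (Fin.last (m + 1))) := (Fin.snoc_init_self z₁).symm
    have h2 : z₂ = Fin.snoc (Fin.init z₂) (z₂ (Fin.last (m + 1))) := (Fin.snoc_init_self z₂).symm
    rw [h1, h2, hy]
    congr 1
    refine (hψmono _ hz₂.1).injOn ?_ hz₂.2 ?_
    · rw [← hy]; exact hz₁.2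
    · show ψ (Fin.snoc (Fin.init z₂) (z₁ (Fin.last (m + 1)))) = ψ (Fin.snoc (Fin.init z₂) (z₂ (Fin.last (m + 1))))
      rw [← hy, ← h1, hl, hy, ← h2]
  · -- image
    ext w
    simp only [mem_image]
    constructor
    · rintro ⟨z, hz, rfl⟩
      obtain ⟨hy, hza, hzb⟩ := KZlog.mem_band.1 hz
      have hzs : z = Fin.snoc (Fin.init z) (z (Fin.last (m + 1))) := (Fin.snoc_init_self z).symm
      show Φ z ∈ _
      simp only [hΦ]
      refine KZlog.snoc_mem_band.2 ⟨hy, ?_, ?_⟩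
      · have := (hψmono _ hy).monotoneOn ⟨le_rfl, hab _ hy⟩ ⟨hza, hzb⟩ hza
        rwa [← hzs] at this
      · have := (hψmono _ hy).monotoneOn ⟨hza, hzb⟩ ⟨hab _ hy, le_rfl⟩ hzb
        rwa [← hzs] at this
    · intro hw
      obtain ⟨hy, hwa, hwb⟩ := KZlog.mem_band.1 hw
      obtain ⟨t, ht, hwt⟩ := intermediate_value_Icc (hab _ hy) (hcont _ hy) ⟨hwa, hwb⟩
      refine ⟨Fin.snoc (Fin.init w) t, KZlog.snoc_mem_band.2 ⟨hy, ht⟩, ?_⟩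
      have hwt' : ψ (Fin.snoc (Fin.init w) t) = w (Fin.last (m + 1)) := hwt
      simp only [hΦ, Fin.init_snoc]
      rw [hwt', Fin.snoc_init_self]
  · -- `Φ` fixes `z 0`
    show Φ z 0 = z 0
    simp only [hΦ]
    have h0 : (0 : Fin (m + 1 + 1)) = Fin.castSucc 0 := rfl
    rw [h0, Fin.snoc_castSucc]
    rfl

/-- **Fibrewise substitutions along the last coordinate are fibred changes of variables.** See the
module docstring: for representations `r` on the band and `r'` on the image band with
`r.integrand z = r'.integrand (Φ z) · ∂ψ/∂t (z)` (`∂ψ/∂t > 0` on the band),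
`[r] − [r'] ∈ fibredRelations`. [Kontsevich–Zagier 2001, §1.2, rule (2)] [folklore] -/
theorem of_sub_of_mem_fibredRelations_fibreSubst {m : ℕ} {G : Set (Fin (m + 1) → ℝ)}
    {a b : (Fin (m + 1) → ℝ) → ℝ} (ha : IsSemialgebraicFunOn ℚ G a)
    (hb : IsSemialgebraicFunOn ℚ G b) (hab : ∀ y ∈ G, a y ≤ b y)
    {ψ : (Fin (m + 1 + 1) → ℝ) → ℝ} {U : Set (Fin (m + 1 + 1) → ℝ)} (hUo : IsOpen U)
    (hBU : KZlog.band G a b ⊆ U) (hψsa : IsSemialgebraicFunOn ℚ (KZlog.band G a b) ψ)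
    (hψd : DifferentiableOn ℝ ψ U)
    (hψpos : ∀ z ∈ KZlog.band G a b, 0 < fderiv ℝ ψ z (Pi.single (Fin.last (m + 1)) 1))
    (hψmono : ∀ y ∈ G, StrictMonoOn (fun t : ℝ => ψ (Fin.snoc y t)) (Icc (a y) (b y)))
    (r r' : IntegralRep (m + 1 + 1)) (hr : r.domain = KZlog.band G a b)
    (hr' : r'.domain = KZlog.band G (fun y => ψ (Fin.snoc y (a y))) (fun y => ψ (Fin.snoc y (b y))))
    (hint : ∀ z ∈ r.domain, r.integrand z =
      r'.integrand (Fin.snoc (Fin.init z) (ψ z)) * fderiv ℝ ψ z (Pi.single (Fin.last (m + 1)) 1)) :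
    of r - of r' ∈ fibredRelations := by
  obtain ⟨Φ', hsa, hderiv, hinj, himg, hdet, h0⟩ :=
    fibreSubst_data ha hb hab hUo hBU hψsa hψd hψmono
  refine mem_fibredRelations_of_mem_fibredChangeOfVariablesRel
    ⟨m + 1, r, r', fun z => Fin.snoc (Fin.init z) (ψ z), Φ', hr ▸ hsa, fun z hz => ?_,
      hr ▸ hinj, by rw [hr', hr, himg], fun z hz => ?_, fun z _ => h0 z, rfl⟩
  · rw [hr] at hz ⊢; exact hderiv z hz
  · rw [hint z hz, hdet, abs_of_pos (hψpos z (hr ▸ hz))]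

/-- **Pulling a representation back along a fibrewise substitution.** With the data of the module
docstring, `∂ψ/∂t` `ℚ`-semialgebraic and positive on the band, and a representation `r'` on the
IMAGE band, there is a representation `r` on the band with integrand `r'.integrand (Φ z) · ∂ψ/∂t (z)`
(integrable by the change-of-variables formula
`MeasureTheory.integrableOn_image_iff_integrableOn_abs_det_fderiv_smul`), and
`[r] − [r'] ∈ fibredRelations`. [Kontsevich–Zagier 2001, §1.2, rule (2)] [folklore] -/
theorem exists_fibreSubst_pullback {m : ℕ} {G : Set (Fin (m + 1) → ℝ)}
    {a b : (Fin (m + 1) → ℝ) → ℝ} (ha : IsSemialgebraicFunOn ℚ G a)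
    (hb : IsSemialgebraicFunOn ℚ G b) (hab : ∀ y ∈ G, a y ≤ b y)
    {ψ : (Fin (m + 1 + 1) → ℝ) → ℝ} {U : Set (Fin (m + 1 + 1) → ℝ)} (hUo : IsOpen U)
    (hBU : KZlog.band G a b ⊆ U) (hψsa : IsSemialgebraicFunOn ℚ (KZlog.band G a b) ψ)
    (hψd : DifferentiableOn ℝ ψ U)
    (hψ'sa : IsSemialgebraicFunOn ℚ (KZlog.band G a b) (fun z => fderiv ℝ ψ z (Pi.single (Fin.last (m + 1)) 1)))
    (hψpos : ∀ z ∈ KZlog.band G a b, 0 < fderiv ℝ ψ z (Pi.single (Fin.last (m + 1)) 1))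
    (hψmono : ∀ y ∈ G, StrictMonoOn (fun t : ℝ => ψ (Fin.snoc y t)) (Icc (a y) (b y)))
    (r' : IntegralRep (m + 1 + 1))
    (hr' : r'.domain = KZlog.band G (fun y => ψ (Fin.snoc y (a y))) (fun y => ψ (Fin.snoc y (b y)))) :
    ∃ r : IntegralRep (m + 1 + 1), r.domain = KZlog.band G a b ∧
      (r.integrand = fun z => r'.integrand (Fin.snoc (Fin.init z) (ψ z)) *
        fderiv ℝ ψ z (Pi.single (Fin.last (m + 1)) 1)) ∧
      of r - of r' ∈ fibredRelations := by
  obtain ⟨Φ', hsa, hderiv, hinj, himg, hdet, h0⟩ :=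
    fibreSubst_data ha hb hab hUo hBU hψsa hψd hψmono
  have hBsa : IsSemialgebraic ℚ (KZlog.band G a b) := KZlog.isSemialgebraic_band ha hb
  have hBm : MeasurableSet (KZlog.band G a b) := IsSemialgebraic.measurableSet_holds hBsa
  -- semialgebraicity of the pulled-back integrand
  have hcomp : IsSemialgebraicFunOn ℚ (KZlog.band G a b)
      (fun z => r'.integrand (Fin.snoc (Fin.init z) (ψ z))) :=
    IsSemialgebraicFunOn.comp_isSemialgebraicMapOn_holds r'.isSemialgebraicFunOn_integrand hsa
      (by rw [hr', ← himg]; exact mapsTo_image _ _)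
  have hfsa := IsSemialgebraicFunOn.mul_holds hcomp hψ'sa
  -- integrability by the change-of-variables formula
  have hint : IntegrableOn (fun z => r'.integrand (Fin.snoc (Fin.init z) (ψ z)) *
      fderiv ℝ ψ z (Pi.single (Fin.last (m + 1)) 1)) (KZlog.band G a b) := by
    have h := (integrableOn_image_iff_integrableOn_abs_det_fderiv_smul volume hBm hderiv hinj
      r'.integrand).mp (by rw [himg, ← hr']; exact r'.integrableOn)
    refine h.congr_fun (fun z hz => ?_) hBm
    simp only [smul_eq_mul, hdet, abs_of_pos (hψpos z hz)]
    ring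
  refine ⟨⟨_, _, hBsa, hfsa, hint⟩, rfl, rfl, ?_⟩
  exact of_sub_of_mem_fibredRelations_fibreSubst ha hb hab hUo hBU hψsa hψd hψpos hψmono _ r' rfl hr'
    fun z _ => rfl

end Summit.KontsevichZagierPeriods.ValuedFieldSpecialisation
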